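import Literature.NumberTheory.EllipticCurves.UniversalOrdinaryFunctionalEquation
import Literature.NumberTheory.EllipticCurves.PadicSigmaOfZetaProofs
import HarnessLib

/-!
# Specialising the universal `p`-adic sigma function: Blakestad–Grant's Thm. 15 as the last
# reduction of `mazur_tate_sigma_existsUnique` (proofs only)

Trunk T-NT-EC (Literature/NumberTheory/EllipticCurves). Blakestad–Grant (*On the universal
`p`-adic sigma and Weierstrass zeta functions*, J. Number Theory 249 (2023), arXiv:1903.02480)
prove the integrality of the Mazur–Tate sigma function ONCE, for the universal ordinary curve
`𝓔 : y² = x³ + A₄x + A₆` over `R̂ = ℤ[A₄,A₆][1/H]^∧_p` (their Thm. 1: `σ = t·exp(g) ∈ R̂⟦t⟧`,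
`g = ∫ζ̃ω`), and then SPECIALISE (Thm. 15): for an elliptic curve `y² = x³ + a₄x + a₆` over a
`p`-adically complete ring `S` with unit Hasse invariant, the map `ρ : R̂ → S`, `Aᵢ ↦ aᵢ`,
carries `σ_{𝓔/R̂}` to the Mazur–Tate sigma function of the curve ("the expansion of elements …
in terms of `t` and the action of `D` commute with this base change", §2.1).

The tree has every ingredient of this last step — the ring `R̂ = completeRing p`, the universal
curve `universalCurve p`, the specialisation `specialize` (`UniversalOrdinaryRing.lean`), the
ring `K = R̂[1/p] = completeRingQ p` in which `g` and `exp g` live and the subring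
`intSubring p = R̂ ⊆ K` in which Cor. 6(c) concludes (`UniversalOrdinaryFunctionalEquation.lean`),
the construction `σ = z·exp(sigmaExpArg)` and the fact that it is a Mazur–Tate pair over `ℤ_p`
as soon as `exp(sigmaExpArg)` is `p`-integral (`PadicSigmaOfZetaProofs.lean`), and the transport
from short `p`-integral models to the named fact (`PadicSigmaVariableChangeProofs.lean`) — but
not the step itself. This file proves it:

* `map_formalPrimitive`, `map_formalOmega`, `map_sigmaExpArg`, `map_sigmaOfZeta` — `∫`, `ω`,
  `g = ∫ζ̃ω` and `σ = z·exp g` commute with ring maps of `ℚ`-algebras (Blakestad–Grant §2.1: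
  expansions commute with base change; `exp ∘ subst` is the tree's
  `Literature.RingTheory.FormalGroups.map_exp_subst`);
* `exists_ringHom_completeRingQ_padic` — a ring map `ρ : R̂ → ℤ_p` extends to
  `ρ_K : K = R̂[1/p] → ℚ_p`;
* `map_zetaSeries_eq` — the zeta equation `zΛ' - Λ = -(X - βz²)W` is preserved by base change;
* `exists_even_zetaSeries_universalCurve` — Thm. 2 for `𝓔/R̂` (`p ≥ 5`): an even zeta series
  `Λ = 1 + ⋯ ∈ R̂⟦z⟧` with its constant `β ∈ R̂` (the tree's `exists_padicWeierstrassZetaConst`,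
  `exists_padicWeierstrassZetaSeries` on the base `R̂`, whose hypotheses are the theorems of
  `UniversalOrdinaryRing.lean`);
* **`mazur_tate_sigma_existsUnique_of_universal_exp_sigmaExpArg_integral`** — the named fact
  `WeierstrassCurve.mazur_tate_sigma_existsUnique` (Mazur–Stein–Tate 2006, Thm. 1.3) follows from
  Blakestad–Grant's Thm. 1 in the literal form in which their proof ends: *for every `p ≥ 5`
  there is an even zeta series `Λ` of `𝓔/R̂` such that `exp(sigmaExpArg 𝓔_K Λ_K)` has all its
  coefficients in `R̂ ⊆ K`* (the output of `coeff_exp_subst_mem_intSubring'`, Cor. 6(c));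
  variants `…_integral'` (for ALL even zeta series) and `…_of_universal_exists_map_eq_exp`
  (the `∃ s ∈ R̂⟦t⟧, s ↦ exp(g)` form of `exists_map_eq_exp_subst`).

So after this file, on Blakestad–Grant's route, the existence half of the named fact is EXACTLY
their Thm. 1 over `R̂` (Prop. 7, Lemma 12, Prop. 13(b) feeding Cor. 6(c)); nothing below `R̂`
(no `ℤ_p`-curve, no minimal model, no uniqueness) remains.

## The argument (Blakestad–Grant, proof of Thm. 15)

Given `p ≥ 5` and a `p`-integral short model `V = W₀ ⊗ ℚ_p`, `W₀ : y² = x³ + a₄x + a₆` over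
`ℤ_p` with `‖w_{p-1}‖ = 1`: the Hasse coefficient of `W₀` is a unit
(`isUnit_hasseCoeff_iff_isUnit_coeff_formalInvDiff`), so `ρ = specialize p a₄ a₆ _ : R̂ → ℤ_p`
exists with `ρ_*𝓔 = W₀`; `ρ` extends to `ρ_K : K → ℚ_p`. Push the universal data along `ρ`:
`Λ₀ = ρ(Λ)` is an even zeta series of `W₀` with constant `ρ(β)` (`map_zetaSeries_eq`), and
`ρ_K(exp(g_𝓔)) = exp(ρ_K(g_𝓔)) = exp(g_V)` with `g_V = sigmaExpArg V (Λ₀ ⊗ ℚ_p)`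
(`Literature.RingTheory.FormalGroups.map_exp_subst`, `map_sigmaExpArg`); coefficients in `R̂` go
to coefficients in `ℤ_p`. Hence
`σ = z·exp(g_V)` is a Mazur–Tate pair of `V` (`isMazurTateSigmaPair_sigmaOfZeta`), and
`mazur_tate_sigma_existsUnique_of_exists_shortModel` concludes.

## Sources

* C. Blakestad, D. Grant, J. Number Theory 249 (2023) 348–376 (arXiv:1903.02480): §2.1
  ("under any specialization `ρ : R → S` … the expansion … in terms of `t` and the action of `D`
  commute with this base change"), Thm. 1, Thm. 2, §4 Thm. 15 ("`ρ` extends to a map on `R_H`,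
  and then to a map on `R̂` since `S` is `p`-complete … `σ_{E/S}(t) = ρ(σ_{𝓔/R̂})(t)`").
  [BlakestadGrant2023]
* B. Mazur, W. Stein, J. Tate, *Computation of `p`-adic heights and log convergence*, Doc. Math.
  Extra Vol. Coates (2006), Thm. 1.3. [MazurSteinTate2006]
* B. Mazur, J. Tate, *The `p`-adic sigma function*, Duke Math. J. 62 (1991), Thm. 3.1.

Pure proof file: no definitions, no named facts.
-/

noncomputable section

open PowerSeries Literature.NumberTheory.EllipticCurves
open Literature.NumberTheory.EllipticCurves.UniversalOrdinary

/-! ### Base change of `∫`, `ω`, `g = ∫ζ̃ω`, `exp g` along maps of `ℚ`-algebras -/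

namespace Literature.NumberTheory.EllipticCurves

section MapQ

variable {K K' : Type*} [CommRing K] [CommRing K'] [Algebra ℚ K] [Algebra ℚ K'] (f : K →+* K')

/-- **`∫` commutes with base change**: `f(∫H) = ∫ f(H)` (ring maps of `ℚ`-algebras are
`ℚ`-linear). [Blakestad–Grant 2023, §2.1 (expansions commute with specialisation)] [folklore] -/
theorem map_formalPrimitive (H : K⟦X⟧) :
    PowerSeries.map f (formalPrimitive H) = formalPrimitive (PowerSeries.map f H) := by
  ext n
  rcases n with _ | n
  · rw [coeff_map, coeff_zero_eq_constantCoeff_apply, constantCoeff_formalPrimitive,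
      coeff_zero_eq_constantCoeff_apply, constantCoeff_formalPrimitive, map_zero]
  · rw [coeff_map, coeff_succ_formalPrimitive, coeff_succ_formalPrimitive, map_mul,
      f.map_rat_algebraMap, coeff_map]

end MapQ

end Literature.NumberTheory.EllipticCurves

namespace WeierstrassCurve

section MapQ

variable {K K' : Type*} [CommRing K] [CommRing K'] [Algebra ℚ K] [Algebra ℚ K'] (f : K →+* K')
  (W : WeierstrassCurve K)

/-- **`ω` commutes with base change** over `ℚ`-algebras (`formalOmega = formalInvDiff`, and the
latter is defined over any ring). [Silverman AEC IV.1; Blakestad–Grant 2023, §2.1] [folklore] -/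
theorem map_formalOmega : PowerSeries.map f W.formalOmega = (W.map f).formalOmega := by
  rw [← W.formalInvDiff_eq_formalOmega, ← (W.map f).formalInvDiff_eq_formalOmega, W.map_formalInvDiff f]

/-- **`g = ∫ζ̃ω` commutes with base change**: `f(sigmaExpArg W Λ) = sigmaExpArg (f_*W) (f Λ)`.
[Blakestad–Grant 2023, §2.1 and proof of Thm. 15 (`σ_{E/S} = ρ(σ_{𝓔/R̂})`)] [folklore] -/
theorem map_sigmaExpArg (Λ : K⟦X⟧) :
    PowerSeries.map f (W.sigmaExpArg Λ) = (W.map f).sigmaExpArg (PowerSeries.map f Λ) := by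
  rw [sigmaExpArg, map_formalPrimitive, sigmaExpArg]
  congr 1
  ext n
  rw [coeff_map, coeff_mk, coeff_mk, ← coeff_map, map_sub, map_mul, W.map_formalOmega f, map_one]

/-- `σ = z·exp g` commutes with base change. [cite: BlakestadGrant2023, Thm. 15] -/
theorem map_sigmaOfZeta (Λ : K⟦X⟧) :
    PowerSeries.map f (W.sigmaOfZeta Λ) = (W.map f).sigmaOfZeta (PowerSeries.map f Λ) := by
  rw [sigmaOfZeta, map_mul, map_X,
    Literature.RingTheory.FormalGroups.map_exp_subst f (constantCoeff_sigmaExpArg Λ),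
    W.map_sigmaExpArg f, sigmaOfZeta]

end MapQ

section MapZeta

variable {R S : Type*} [CommRing R] [CommRing S] (φ : R →+* S) (W : WeierstrassCurve R)

/-- **The zeta equation is preserved by base change**: if `zΛ' - Λ = -(X - βz²)·W` over `R`
then the same holds for `φ(Λ)`, `φ(β)` on `φ_*W`. [Blakestad–Grant 2023, §2.1 ("the action of
`D` commute[s] with this base change")] [folklore] -/
theorem map_zetaSeries_eq {β : R} {Λ : R⟦X⟧}
    (hΛ : X * d⁄dX R Λ - Λ = -((W.formalXMulSq - C β * X ^ 2) * W.formalInvDiff)) :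
    X * d⁄dX S (PowerSeries.map φ Λ) - PowerSeries.map φ Λ =
      -(((W.map φ).formalXMulSq - C (φ β) * X ^ 2) * (W.map φ).formalInvDiff) := by
  have h := congrArg (PowerSeries.map φ) hΛ
  rw [map_sub, map_mul, map_X, ← derivative_map, map_neg, map_mul, map_sub, map_mul, map_C,
    map_pow, map_X, W.map_formalXMulSq φ, W.map_formalInvDiff φ] at h
  exact h

/-- Base change preserves `Λ(0) = 1`. [folklore] -/
theorem constantCoeff_map_eq_one {Λ : R⟦X⟧} (h0 : constantCoeff Λ = 1) :
    constantCoeff (PowerSeries.map φ Λ) = 1 := by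
  rw [← coeff_zero_eq_constantCoeff_apply, coeff_map, coeff_zero_eq_constantCoeff_apply, h0, map_one]

/-- Base change preserves evenness. [folklore] -/
theorem rescale_neg_one_map_of_eq {Λ : R⟦X⟧} (hev : rescale (-1 : R) Λ = Λ) :
    rescale (-1 : S) (PowerSeries.map φ Λ) = PowerSeries.map φ Λ := by
  rw [show (-1 : S) = φ (-1) by rw [map_neg, map_one], rescale_map, hev]

end MapZeta

end WeierstrassCurve

/-! ### The universal curve: its even zeta series, and `ρ_K : K → ℚ_p` -/

namespace Literature.NumberTheory.EllipticCurves.UniversalOrdinary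

variable (p : ℕ) [Fact p.Prime]

/-- **Thm. 2 for the universal ordinary curve**: for `p ≥ 5` there are `β ∈ R̂` and an EVEN
series `Λ = 1 + ⋯ ∈ R̂⟦z⟧` with `zΛ' - Λ = -(X - βz²)·W_𝓔`, i.e. `Dζ = -x + β` for the odd
Laurent series `ζ = Λ/z` — Blakestad–Grant's universal `p`-adic Weierstrass zeta function
(the tree's Thm. 2 over the abstract base, instantiated on `R̂`: complete, torsion-free, all
Hasse coefficients `w_{pⁿ-1}` units). [Blakestad–Grant 2023, Thm. 2]
[cite: BlakestadGrant2023, Thm. 2] -/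
theorem exists_even_zetaSeries_universalCurve (hp5 : 5 ≤ p) :
    ∃ β : completeRing p, ∃ Λ : PowerSeries (completeRing p),
      constantCoeff Λ = 1 ∧ rescale (-1 : completeRing p) Λ = Λ ∧
      X * d⁄dX (completeRing p) Λ - Λ =
        -(((universalCurve p).formalXMulSq - C β * X ^ 2) * (universalCurve p).formalInvDiff) := by
  haveI := isAddTorsionFree_completeRing p hp5
  have hp2 : p ≠ 2 := by omega
  obtain ⟨β, hβ⟩ := (universalCurve p).exists_padicWeierstrassZetaConst p hp2
    (isUnit_coeff_formalInvDiff_universalCurve_pow p hp5)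
  obtain ⟨Λ₀, h0, hΛ₀, -⟩ := (universalCurve p).exists_padicWeierstrassZetaSeries hβ
  obtain ⟨hΛ₁, h0₁⟩ := zetaSeries_sub_C_mul_X hΛ₀ (coeff 1 Λ₀)
  refine ⟨β, Λ₀ - C (coeff 1 Λ₀) * X, by rw [h0₁, h0], ?_, hΛ₁⟩
  refine rescale_neg_one_eq_self_of_zetaSeries hΛ₁
    ((universalCurve p).rescale_neg_one_formalXMulSq_sub_mul_formalInvDiff β) ?_
  rw [map_sub, coeff_C_mul, coeff_one_X, mul_one, sub_self]

/-- **`ρ` extends to `K = R̂[1/p]`**: a ring map `ρ : R̂ → ℤ_p` (e.g. `specialize`) induces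
`ρ_K : K → ℚ_p` with `ρ_K|_{R̂} = ρ` (`p` is invertible in `ℚ_p`). [Blakestad–Grant 2023,
Thm. 15 (specialisation of `σ̃ = exp g`, `g ∈ (R̂ ⊗ ℚ)⟦t⟧`)] [folklore] -/
theorem exists_ringHom_completeRingQ_padic (ρ : completeRing p →+* ℤ_[p]) :
    ∃ ρK : completeRingQ p →+* ℚ_[p],
      ∀ x, ρK (algebraMap (completeRing p) (completeRingQ p) x) = ((ρ x : ℤ_[p]) : ℚ_[p]) := by
  have hp : p.Prime := Fact.out
  have hu : IsUnit (((PadicInt.Coe.ringHom (p := p)).comp ρ) (p : completeRing p)) := by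
    rw [map_natCast]
    exact isUnit_iff_ne_zero.mpr (Nat.cast_ne_zero.mpr hp.ne_zero)
  refine ⟨IsLocalization.Away.lift (p : completeRing p) hu, fun x => ?_⟩
  rw [IsLocalization.Away.lift_eq]
  rfl

/-- Coefficients in `R̂ ⊆ K` specialise to `p`-integral coefficients: if `c ∈ intSubring p` then
`‖ρ_K(c)‖ ≤ 1`. [folklore] -/
theorem norm_le_one_of_mem_intSubring {ρ : completeRing p →+* ℤ_[p]}
    {ρK : completeRingQ p →+* ℚ_[p]}
    (hρK : ∀ x, ρK (algebraMap (completeRing p) (completeRingQ p) x) = ((ρ x : ℤ_[p]) : ℚ_[p]))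
    {c : completeRingQ p} (hc : c ∈ intSubring p) : ‖ρK c‖ ≤ 1 := by
  obtain ⟨x, rfl⟩ := hc
  rw [hρK, ← PadicInt.norm_def]
  exact PadicInt.norm_le_one _

end Literature.NumberTheory.EllipticCurves.UniversalOrdinary

/-! ### Thm. 15: the universal integrality specialises to every ordinary curve over `ℤ_p` -/

namespace WeierstrassCurve

variable {p : ℕ} [Fact p.Prime]

/-- **Specialisation of the universal sigma data to a short ordinary model over `ℤ_p`**
(Blakestad–Grant, Thm. 15). Let `p ≥ 5`, `W₀ : y² = x³ + a₄x + a₆` over `ℤ_p` with unit Hasse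
coefficient `w_{p-1}`, `V = W₀ ⊗ ℚ_p`. If `Λ` is an even zeta series of `𝓔/R̂` (constant `β`)
such that `exp(sigmaExpArg 𝓔_K Λ_K)` has coefficients in `R̂`, then along
`ρ = specialize : R̂ → ℤ_p` (`ρ_*𝓔 = W₀`) the series `Λ₀ = ρ(Λ)` is an even zeta series of `W₀`
(constant `ρ(β)`) and `exp(sigmaExpArg V (Λ₀ ⊗ ℚ_p))` is `p`-integral; consequently
`(z·exp(sigmaExpArg V (Λ₀ ⊗ ℚ_p)), -ρ(β))` is a Mazur–Tate sigma pair of `V`.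
[Blakestad–Grant 2023, Thm. 15 ("`σ_{E/S}(t) = ρ(σ_{𝓔/R̂})(t)`")] [cite: BlakestadGrant2023, Thm. 15] -/
theorem exists_isMazurTateSigmaPair_of_universal (hp : 5 ≤ p) (W₀ : WeierstrassCurve ℤ_[p])
    [W₀.IsShortNF] (hA : IsUnit (coeff (p - 1) W₀.formalInvDiff))
    (V : WeierstrassCurve ℚ_[p]) [V.IsCharNeTwoNF] (hV : W₀.map (algebraMap ℤ_[p] ℚ_[p]) = V)
    {β : completeRing p} {Λ : PowerSeries (completeRing p)} (h0 : constantCoeff Λ = 1)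
    (hev : rescale (-1 : completeRing p) Λ = Λ)
    (hΛ : X * d⁄dX (completeRing p) Λ - Λ =
      -(((universalCurve p).formalXMulSq - C β * X ^ 2) * (universalCurve p).formalInvDiff))
    (hint : ∀ n, coeff n ((exp (completeRingQ p)).subst
      (((universalCurve p).map (algebraMap (completeRing p) (completeRingQ p))).sigmaExpArg
        (PowerSeries.map (algebraMap (completeRing p) (completeRingQ p)) Λ))) ∈ intSubring p) :
    ∃ ρ : completeRing p →+* ℤ_[p], (universalCurve p).map ρ = W₀ ∧
      V.IsMazurTateSigmaPair
        (V.sigmaOfZeta (PowerSeries.map (algebraMap ℤ_[p] ℚ_[p]) (PowerSeries.map ρ Λ)))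
        (-((ρ β : ℤ_[p]) : ℚ_[p])) := by
  haveI := padicInt_isAdicComplete_span_p p
  -- `W₀` is literally `⟨0, 0, 0, a₄, a₆⟩`
  have hW₀ : (⟨0, 0, 0, W₀.a₄, W₀.a₆⟩ : WeierstrassCurve ℤ_[p]) = W₀ := by
    ext
    · exact W₀.a₁_of_isShortNF.symm
    · exact W₀.a₂_of_isShortNF.symm
    · exact W₀.a₃_of_isShortNF.symm
    · rfl
    · rfl
  -- the Hasse coefficient of `W₀` is a unit, so `ρ = specialize` exists
  have hH : IsUnit ((⟨0, 0, 0, W₀.a₄, W₀.a₆⟩ : WeierstrassCurve ℤ_[p]).hasseCoeff p) := by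
    rw [hW₀]
    exact (isUnit_hasseCoeff_iff_isUnit_coeff_formalInvDiff p (by omega) W₀).mpr hA
  set ρ : completeRing p →+* ℤ_[p] := specialize p W₀.a₄ W₀.a₆ hH with hρdef
  have hρ : (universalCurve p).map ρ = W₀ := (universalCurve_map_specialize p W₀.a₄ W₀.a₆ hH).trans hW₀
  refine ⟨ρ, hρ, ?_⟩
  -- `ρ_K : K → ℚ_p` over `ρ`
  obtain ⟨ρK, hρK⟩ := exists_ringHom_completeRingQ_padic p ρ
  have hcomp : ρK.comp (algebraMap (completeRing p) (completeRingQ p)) =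
      (algebraMap ℤ_[p] ℚ_[p]).comp ρ := RingHom.ext fun x => by
    rw [RingHom.comp_apply, RingHom.comp_apply, hρK x]; rfl
  -- the specialised zeta data
  set Λ₀ : ℤ_[p]⟦X⟧ := PowerSeries.map ρ Λ with hΛ₀def
  have h0' : constantCoeff Λ₀ = 1 := constantCoeff_map_eq_one ρ h0
  have hev' : rescale (-1 : ℤ_[p]) Λ₀ = Λ₀ := rescale_neg_one_map_of_eq ρ hev
  have hΛ₀ : X * d⁄dX ℤ_[p] Λ₀ - Λ₀ = -((W₀.formalXMulSq - C (ρ β) * X ^ 2) * W₀.formalInvDiff) := by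
    have h := (universalCurve p).map_zetaSeries_eq ρ hΛ
    rwa [hρ] at h
  -- `ρ_K(exp g_𝓔) = exp g_V`
  have hcurve : ((universalCurve p).map (algebraMap (completeRing p) (completeRingQ p))).map ρK = V := by
    rw [map_map, hcomp, ← map_map, hρ, hV]
  have hser : PowerSeries.map ρK (PowerSeries.map (algebraMap (completeRing p) (completeRingQ p)) Λ) =
      PowerSeries.map (algebraMap ℤ_[p] ℚ_[p]) Λ₀ := by
    ext n
    rw [coeff_map, coeff_map, hρK, hΛ₀def, coeff_map, coeff_map]
    rfl
  have hexp : PowerSeries.map ρK ((exp (completeRingQ p)).subst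
      (((universalCurve p).map (algebraMap (completeRing p) (completeRingQ p))).sigmaExpArg
        (PowerSeries.map (algebraMap (completeRing p) (completeRingQ p)) Λ))) =
      (exp ℚ_[p]).subst (V.sigmaExpArg (PowerSeries.map (algebraMap ℤ_[p] ℚ_[p]) Λ₀)) := by
    rw [Literature.RingTheory.FormalGroups.map_exp_subst ρK (constantCoeff_sigmaExpArg _),
      map_sigmaExpArg, hcurve, hser]
  -- integrality of `exp g_V`
  have hint₀ : ∀ n, ‖coeff n ((exp ℚ_[p]).subst
      (V.sigmaExpArg (PowerSeries.map (algebraMap ℤ_[p] ℚ_[p]) Λ₀)))‖ ≤ 1 := by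
    intro n
    rw [← hexp, coeff_map]
    exact norm_le_one_of_mem_intSubring p hρK (hint n)
  exact isMazurTateSigmaPair_sigmaOfZeta V W₀ hV h0' hev' hΛ₀ hint₀

/-- **`mazur_tate_sigma_existsUnique` (Mazur–Stein–Tate 2006, Thm. 1.3) reduced to
Blakestad–Grant's Thm. 1 over the universal ring `R̂`, in the form in which their proof ends.**
Suppose that for every prime `p ≥ 5` there are `β ∈ R̂` and an even zeta series
`Λ = 1 + ⋯ ∈ R̂⟦z⟧` of the universal ordinary curve `𝓔 = universalCurve p`
(`zΛ' - Λ = -(X - βz²)·W_𝓔`; such data exist, `exists_even_zetaSeries_universalCurve`) for which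
`exp(g)`, `g = ∫ζ̃ω = sigmaExpArg 𝓔_K Λ_K ∈ K⟦t⟧` (`K = R̂[1/p] = completeRingQ p`), has all
its coefficients in `R̂ = intSubring p` — Blakestad–Grant's Thm. 1 ("`σ̃(t)` — and hence `σ(t)`
— has coefficients in `R̂`"), the conclusion of the tree's Cor. 6(c)
`coeff_exp_subst_mem_intSubring'` once `α`, `t'` and the functional equation of Prop. 13(b) are
supplied. Then the named fact holds: every `p`-integral short ordinary model over `ℚ_p` is a
specialisation of `𝓔` (Thm. 15, `exists_isMazurTateSigmaPair_of_universal`), and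
`mazur_tate_sigma_existsUnique_of_exists_shortModel` (transport to the minimal model and the
uniqueness half) concludes. [Blakestad–Grant 2023, Thm. 1 and Thm. 15; Mazur–Stein–Tate 2006,
Thm. 1.3; Mazur–Tate 1991, Thm. 3.1] [cite: BlakestadGrant2023, Thm. 15] -/
theorem mazur_tate_sigma_existsUnique_of_universal_exp_sigmaExpArg_integral
    (huniv : ∀ (p : ℕ) [Fact p.Prime], 5 ≤ p →
      ∃ β : completeRing p, ∃ Λ : PowerSeries (completeRing p),
        constantCoeff Λ = 1 ∧ rescale (-1 : completeRing p) Λ = Λ ∧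
        X * d⁄dX (completeRing p) Λ - Λ =
          -(((universalCurve p).formalXMulSq - C β * X ^ 2) * (universalCurve p).formalInvDiff) ∧
        ∀ n, coeff n ((exp (completeRingQ p)).subst
          (((universalCurve p).map (algebraMap (completeRing p) (completeRingQ p))).sigmaExpArg
            (PowerSeries.map (algebraMap (completeRing p) (completeRingQ p)) Λ))) ∈ intSubring p) :
    mazur_tate_sigma_existsUnique := by
  refine mazur_tate_sigma_existsUnique_of_exists_shortModel fun p _ V _ _ hp hΔ hc => ?_
  -- an integral short model `W₀/ℤ_p` of `V`
  set W₀ : WeierstrassCurve ℤ_[p] := integralModel ℤ_[p] V with hW₀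
  have hV : W₀.map (algebraMap ℤ_[p] ℚ_[p]) = V := baseChange_integralModel_eq ℤ_[p] V
  have hinj : Function.Injective (algebraMap ℤ_[p] ℚ_[p]) := IsFractionRing.injective ℤ_[p] ℚ_[p]
  haveI : W₀.IsShortNF := by
    refine ⟨hinj ?_, hinj ?_, hinj ?_⟩
    · rw [map_zero, ← map_a₁, hV, V.a₁_of_isShortNF]
    · rw [map_zero, ← map_a₂, hV, V.a₂_of_isShortNF]
    · rw [map_zero, ← map_a₃, hV, V.a₃_of_isShortNF]
  -- ordinarity read over `ℤ_p`
  have hcoe : coeff (p - 1) V.formalOmega = ((coeff (p - 1) W₀.formalInvDiff : ℤ_[p]) : ℚ_[p]) := by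
    rw [← V.formalInvDiff_eq_formalOmega, ← hV, ← W₀.map_formalInvDiff, coeff_map]; rfl
  have hA : IsUnit (coeff (p - 1) W₀.formalInvDiff) := by
    rw [PadicInt.isUnit_iff, PadicInt.norm_def, ← hcoe]; exact hc
  obtain ⟨β, Λ, h0, hev, hΛ, hint⟩ := huniv p hp
  obtain ⟨ρ, -, hpair⟩ := exists_isMazurTateSigmaPair_of_universal hp W₀ hA V hV h0 hev hΛ hint
  exact ⟨_, _, hpair⟩

/-- The same with the integrality hypothesis for ALL even zeta series of `𝓔/R̂` (they exist by
`exists_even_zetaSeries_universalCurve`; Blakestad–Grant's `ζ_{𝓔/R̂}` is the unique odd one).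
[cite: BlakestadGrant2023, Thm. 15] -/
theorem mazur_tate_sigma_existsUnique_of_universal_exp_sigmaExpArg_integral'
    (huniv : ∀ (p : ℕ) [Fact p.Prime], 5 ≤ p →
      ∀ (β : completeRing p) (Λ : PowerSeries (completeRing p)),
        constantCoeff Λ = 1 → rescale (-1 : completeRing p) Λ = Λ →
        X * d⁄dX (completeRing p) Λ - Λ =
          -(((universalCurve p).formalXMulSq - C β * X ^ 2) * (universalCurve p).formalInvDiff) →
        ∀ n, coeff n ((exp (completeRingQ p)).subst
          (((universalCurve p).map (algebraMap (completeRing p) (completeRingQ p))).sigmaExpArg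
            (PowerSeries.map (algebraMap (completeRing p) (completeRingQ p)) Λ))) ∈ intSubring p) :
    mazur_tate_sigma_existsUnique := by
  refine mazur_tate_sigma_existsUnique_of_universal_exp_sigmaExpArg_integral fun p _ hp => ?_
  obtain ⟨β, Λ, h0, hev, hΛ⟩ := exists_even_zetaSeries_universalCurve p hp
  exact ⟨β, Λ, h0, hev, hΛ, huniv p hp β Λ h0 hev hΛ⟩

/-- The same with integrality in the form "`exp(g)` is the image of a series over `R̂`" (the
output of `exists_map_eq_exp_subst`, Blakestad–Grant's "`σ̃(t)` … has coefficients in `R̂`").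
[cite: BlakestadGrant2023, Thm. 15] -/
theorem mazur_tate_sigma_existsUnique_of_universal_exists_map_eq_exp
    (huniv : ∀ (p : ℕ) [Fact p.Prime], 5 ≤ p →
      ∃ β : completeRing p, ∃ Λ : PowerSeries (completeRing p),
        constantCoeff Λ = 1 ∧ rescale (-1 : completeRing p) Λ = Λ ∧
        X * d⁄dX (completeRing p) Λ - Λ =
          -(((universalCurve p).formalXMulSq - C β * X ^ 2) * (universalCurve p).formalInvDiff) ∧
        ∃ s : PowerSeries (completeRing p),
          PowerSeries.map (algebraMap (completeRing p) (completeRingQ p)) s =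
            (exp (completeRingQ p)).subst
              (((universalCurve p).map (algebraMap (completeRing p) (completeRingQ p))).sigmaExpArg
                (PowerSeries.map (algebraMap (completeRing p) (completeRingQ p)) Λ))) :
    mazur_tate_sigma_existsUnique := by
  refine mazur_tate_sigma_existsUnique_of_universal_exp_sigmaExpArg_integral fun p _ hp => ?_
  obtain ⟨β, Λ, h0, hev, hΛ, s, hs⟩ := huniv p hp
  refine ⟨β, Λ, h0, hev, hΛ, fun n => ?_⟩
  rw [← hs, coeff_map]
  exact ⟨coeff n s, rfl⟩

end WeierstrassCurve
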